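import Summits.CriticalPhenomena.CardyFormulaZ2.Theorems.CardyMeckeFlipFlipErgodicityZ2StubLatticeSecondMomentPairBound
import Summits.CriticalPhenomena.CardyFormulaZ2.Theorems.CardyMeckeFlipFlipErgodicityZ2StubLatticeSecondMomentSums

/-!
# Crux `FlipErgodicityZ2` (stmt-CriticalPhenomena-14825), line `registered`, stub
# `stub_latticeSecondMoment`: the sum over the second edge

Route `Summits/CriticalPhenomena/CardyFormulaZ2/Theses/CardyMeckeFlip`.  Helper file (supports the
crux item).  Third step of the classical second-moment computation (Garban–Pete–Schramm, JAMS 26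
(2013), §4.3–4.4; Kesten 1987), for bond-`ℤ²` in cluster form: for a fixed edge
`e = s(x, x + eᵢ)`, the sum over the edges `e' = s(y, y + e_j)` of a finite set `E` of the pair
probabilities `P(A_e ∩ A_{e'})` (`A_e` = four alternating arms from `e` to the boundary of the
box of radius `m` around it) is split according to the sup-distance `ℓ = ‖y - x‖_∞`:

* NEAR (`ℓ ≤ ℓ₀ = 2N₀ + 6`): at most `2(2ℓ₀+1)²` edges, each term `≤ a(m)`;
* MID (`ℓ₀ < ℓ ≤ m/4`): `16ℓ` edges at distance `ℓ`, each term `≤ a(h)² α₄(4h, m)` with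
  `h = ⌊(ℓ-1)/2⌋` (three independent events, `real_inter_edgeFourArm_le_sq_mul`), and the arm
  algebra `armAlgebra_mid` plus `Σ ℓ^{η-1} ≤ M^η/η` give `≤ (256 K / η) n² a(n) a(m)`;
* FAR (`ℓ > m/4`): each term `≤ a(⌊m/8⌋)² ≤ (256/(c_Q c_L))² a(m)²`, at most `|E|` edges;

where `a(N) = P(edgeFourArm [-N,N]² 0 0)`, `α₄(r,R) = P(fourArmTwoClusters r R)` and the
percolation input consists of the three hypotheses (Q1) edge quasi-multiplicativity, (Q2) annulus
quasi-multiplicativity, (Q3) `α₄(r,R) ≥ c_L (r/R)^{2-η}` — supplied, in the main file of the stub,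
by named facts of the literature.  Result: `sum_pairs_le_of_quasiMult`.
-/

noncomputable section

open MeasureTheory Set Finset
open Literature.Probability.Percolation Literature.Probability.LatticeModels

namespace Summit.CriticalPhenomena.CardyFormulaZ2.Theorems.CardyMeckeFlip

/-- The NEAR count in real form: at most `2(2R+1)²` edges `(y, j)` of any finite set have
`y - x ∈ [-R,R]²`. [folklore] -/
theorem card_filter_fst_sub_mem_box_le :
    ∀ (E : Finset (Site 2 × Fin 2)) (x : Site 2) (R : ℕ),
      (((E.filter fun q => q.1 - x ∈ box 2 R).card : ℕ) : ℝ) ≤ 2 * (2 * (R : ℝ) + 1) ^ 2 := by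
  intro E x R
  have := card_filter_fst_sub_mem_le E x (box 2 R)
  rw [card_box] at this
  exact_mod_cast this

/-- The MID count: at most `16ℓ` edges `(y, j)` of any finite set have `‖y - x‖_∞ = ℓ` (`ℓ ≥ 1`).
[folklore] -/
theorem card_filter_natAbs_eq_le (E : Finset (Site 2 × Fin 2)) (x : Site 2) {ℓ : ℕ} (hℓ : 1 ≤ ℓ) :
    (((E.filter fun q => max ((q.1 - x) 0).natAbs ((q.1 - x) 1).natAbs = ℓ).card : ℕ) : ℝ) ≤
      16 * (ℓ : ℝ) := by
  have h1 : (E.filter fun q => max ((q.1 - x) 0).natAbs ((q.1 - x) 1).natAbs = ℓ) =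
      E.filter fun q => q.1 - x ∈ siteSphere ℓ := by
    refine Finset.filter_congr fun q _ => ?_
    rw [mem_siteSphere_iff_natAbs_eq _ hℓ]
  rw [h1]
  have := card_filter_fst_sub_mem_le E x (siteSphere ℓ)
  rw [card_siteSphere hℓ] at this
  have : (((E.filter fun q => q.1 - x ∈ siteSphere ℓ).card : ℕ) : ℝ) ≤ ((2 * (8 * ℓ) : ℕ) : ℝ) := by
    exact_mod_cast this
  refine this.trans (le_of_eq ?_)
  push_cast
  ring

/-- **The sum over the second edge** (GPS 2013 §4.3–4.4 second-moment computation, bond-`ℤ²`,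
cluster form; NEAR / MID / FAR splitting according to the sup-distance of the two edges).  Let
`a(N) = P(edgeFourArm [-N,N]² 0 0)`, `α₄(r,R) = P(fourArmTwoClusters r R)` satisfy (Q1)–(Q3)
with constants `N₀ ≥ 1`, `c_Q, C_Q, c_L > 0`, `0 < η ≤ 1`, and let `8(N₀+1) ≤ m < n`.  Then for
every edge `(x, i)` and finite set `E` of edges,
`Σ_{(y,j) ∈ E} P(A_{(x,i)} ∩ A_{(y,j)}) ≤ 2(4N₀+13)² a(m) + (4096 C_Q/(η c_Q² c_L²)) n² a(n) a(m)
  + |E| (256/(c_Q c_L))² a(m)²`. [folklore] -/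
theorem sum_pairs_le_of_quasiMult {N₀ : ℕ} {cQ CQ cL η : ℝ} (hN₀ : 1 ≤ N₀) (hcQ : 0 < cQ)
    (hCQ : 0 < CQ) (hcL : 0 < cL) (hη0 : 0 < η) (hη1 : η ≤ 1)
    (hQ1 : ∀ m N : ℕ, N₀ ≤ m → m < N →
      cQ * ((bondPercolation (zdGraph 2) half).real (edgeFourArm (↑(box 2 m) : Set (Site 2)) 0 0) *
        (bondPercolation (zdGraph 2) half).real (fourArmTwoClusters m N)) ≤
        (bondPercolation (zdGraph 2) half).real (edgeFourArm (↑(box 2 N) : Set (Site 2)) 0 0))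
    (hQ2 : ∀ r ρ R : ℕ, 1 ≤ r → r ≤ ρ → ρ ≤ R →
      (bondPercolation (zdGraph 2) half).real (fourArmTwoClusters r ρ) *
        (bondPercolation (zdGraph 2) half).real (fourArmTwoClusters ρ R) ≤
        CQ * (bondPercolation (zdGraph 2) half).real (fourArmTwoClusters r R))
    (hQ3 : ∀ r R : ℕ, 1 ≤ r → r ≤ R →
      cL * ((r : ℝ) / R) ^ (2 - η) ≤ (bondPercolation (zdGraph 2) half).real (fourArmTwoClusters r R))
    {m n : ℕ} (hm : 8 * (N₀ + 1) ≤ m) (hmn : m < n) (x : Site 2) (i : Fin 2)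
    (E : Finset (Site 2 × Fin 2)) :
    ∑ q ∈ E, (bondPercolation (zdGraph 2) half).real
        (edgeFourArm {u : Site 2 | u - x ∈ box 2 m} x i ∩
          edgeFourArm {u : Site 2 | u - q.1 ∈ box 2 m} q.1 q.2) ≤
      2 * (2 * ((2 * N₀ + 6 : ℕ) : ℝ) + 1) ^ 2 *
          (bondPercolation (zdGraph 2) half).real (edgeFourArm (↑(box 2 m) : Set (Site 2)) 0 0) +
        256 * (16 * CQ / (cQ ^ 2 * cL ^ 2)) / η * ((n : ℝ) ^ 2 *
          ((bondPercolation (zdGraph 2) half).real (edgeFourArm (↑(box 2 n) : Set (Site 2)) 0 0) *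
            (bondPercolation (zdGraph 2) half).real (edgeFourArm (↑(box 2 m) : Set (Site 2)) 0 0))) +
        (E.card : ℝ) * ((256 / (cQ * cL)) ^ 2 *
          (bondPercolation (zdGraph 2) half).real (edgeFourArm (↑(box 2 m) : Set (Site 2)) 0 0) ^ 2) := by
  classical
  -- notation
  set P := bondPercolation (zdGraph 2) half with hP
  set a : ℕ → ℝ := fun N => P.real (edgeFourArm (↑(box 2 N) : Set (Site 2)) 0 0) with ha
  set α : ℕ → ℕ → ℝ := fun r R => P.real (fourArmTwoClusters r R) with hα
  have ha0 : ∀ N, 0 ≤ a N := fun N => measureReal_nonneg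
  have hQ1' : ∀ m N : ℕ, N₀ ≤ m → m < N → cQ * (a m * α m N) ≤ a N := hQ1
  have hQ2' : ∀ r ρ R : ℕ, 1 ≤ r → r ≤ ρ → ρ ≤ R → α r ρ * α ρ R ≤ CQ * α r R := hQ2
  have hQ3' : ∀ r R : ℕ, 1 ≤ r → r ≤ R → cL * ((r : ℝ) / R) ^ (2 - η) ≤ α r R := hQ3
  set f : Site 2 × Fin 2 → ℝ := fun q =>
    P.real (edgeFourArm {u : Site 2 | u - x ∈ box 2 m} x i ∩
      edgeFourArm {u : Site 2 | u - q.1 ∈ box 2 m} q.1 q.2) with hf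
  have hf0 : ∀ q, 0 ≤ f q := fun q => measureReal_nonneg
  set ℓ₀ : ℕ := 2 * N₀ + 6 with hℓ₀
  set M₄ : ℕ := m / 4 with hM₄
  set K : ℝ := 16 * CQ / (cQ ^ 2 * cL ^ 2) with hK
  have hK0 : 0 ≤ K := by positivity
  have hm16 : 16 ≤ m := by omega
  have hn0 : (0 : ℝ) < n := by exact_mod_cast (show 0 < n by omega)
  -- the three regimes
  set near : Site 2 × Fin 2 → Prop := fun q => q.1 - x ∈ box 2 ℓ₀ with hnear
  set mid : Site 2 × Fin 2 → Prop := fun q => q.1 - x ∈ box 2 M₄ with hmid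
  have hsplit : ∑ q ∈ E, f q = ∑ q ∈ E.filter near, f q +
      (∑ q ∈ (E.filter fun q => ¬ near q).filter mid, f q +
        ∑ q ∈ (E.filter fun q => ¬ near q).filter fun q => ¬ mid q, f q) := by
    rw [Finset.sum_filter_add_sum_filter_not, Finset.sum_filter_add_sum_filter_not]
  -- NEAR
  have hNEAR : ∑ q ∈ E.filter near, f q ≤ 2 * (2 * (ℓ₀ : ℝ) + 1) ^ 2 * a m := by
    calc ∑ q ∈ E.filter near, f q ≤ ∑ q ∈ E.filter near, a m :=
          Finset.sum_le_sum fun q _ => real_inter_edgeFourArm_le_self x q.1 i q.2 m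
      _ = ((E.filter near).card : ℝ) * a m := by rw [Finset.sum_const, nsmul_eq_mul]
      _ ≤ 2 * (2 * (ℓ₀ : ℝ) + 1) ^ 2 * a m :=
          mul_le_mul_of_nonneg_right (card_filter_fst_sub_mem_box_le E x ℓ₀) (ha0 m)
  -- FAR
  have hFAR : ∑ q ∈ (E.filter fun q => ¬ near q).filter (fun q => ¬ mid q), f q ≤
      (E.card : ℝ) * ((256 / (cQ * cL)) ^ 2 * a m ^ 2) := by
    set h' : ℕ := m / 8 with hh'
    have hh'1 : 1 ≤ h' := by omega
    have hh'N : N₀ ≤ h' := by omega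
    have hh'm : h' < m := by omega
    have hθ : (1 / 16 : ℝ) ≤ (h' : ℝ) / m := by
      have hm0 : (0 : ℝ) < m := by exact_mod_cast (show 0 < m by omega)
      rw [div_le_div_iff₀ (by norm_num) hm0]
      have : (m : ℝ) ≤ 16 * h' := by exact_mod_cast (show m ≤ 16 * h' by omega)
      linarith
    have hratio := armAlgebra_ratio hcQ hcL hη0.le ha0 hQ1' hQ3' hh'1 hh'N hh'm
      (by norm_num : (0 : ℝ) < 1 / 16) hθ
    have hah' : a h' ≤ 256 / (cQ * cL) * a m := by
      rw [div_mul_eq_mul_div, le_div_iff₀ (by positivity)]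
      nlinarith [hratio]
    have hterm : ∀ q ∈ (E.filter fun q => ¬ near q).filter (fun q => ¬ mid q),
        f q ≤ (256 / (cQ * cL)) ^ 2 * a m ^ 2 := by
      intro q hq
      rw [Finset.mem_filter] at hq
      have hfar : q.1 - x ∉ box 2 (2 * h') := fun hb => hq.2 (box_mono 2 (by omega) hb)
      calc f q ≤ a h' ^ 2 := real_inter_edgeFourArm_le_sq i q.2 hh'1 hh'm.le hfar
        _ ≤ (256 / (cQ * cL) * a m) ^ 2 := pow_le_pow_left₀ (ha0 h') hah' 2
        _ = (256 / (cQ * cL)) ^ 2 * a m ^ 2 := by ring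
    calc ∑ q ∈ (E.filter fun q => ¬ near q).filter (fun q => ¬ mid q), f q
        ≤ ∑ q ∈ (E.filter fun q => ¬ near q).filter (fun q => ¬ mid q),
            (256 / (cQ * cL)) ^ 2 * a m ^ 2 := Finset.sum_le_sum hterm
      _ = (((E.filter fun q => ¬ near q).filter (fun q => ¬ mid q)).card : ℝ) *
            ((256 / (cQ * cL)) ^ 2 * a m ^ 2) := by rw [Finset.sum_const, nsmul_eq_mul]
      _ ≤ (E.card : ℝ) * ((256 / (cQ * cL)) ^ 2 * a m ^ 2) := by
          gcongr
          exact (Finset.filter_subset (fun q => ¬ mid q) _).trans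
            (Finset.filter_subset (fun q => ¬ near q) E)
  -- MID
  have hMID : ∑ q ∈ (E.filter fun q => ¬ near q).filter mid, f q ≤
      256 * K / η * ((n : ℝ) ^ 2 * (a n * a m)) := by
    set Emid := (E.filter fun q => ¬ near q).filter mid with hEmid
    set ν : Site 2 × Fin 2 → ℕ := fun q => max ((q.1 - x) 0).natAbs ((q.1 - x) 1).natAbs with hν
    have hmaps : ∀ q ∈ Emid, ν q ∈ Finset.Ioc ℓ₀ M₄ := by
      intro q hq
      rw [hEmid, Finset.mem_filter, Finset.mem_filter] at hq
      obtain ⟨⟨-, hq1⟩, hq2⟩ := hq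
      rw [Finset.mem_Ioc]
      exact ⟨not_le.1 fun hle => hq1 ((mem_box_iff_natAbs_le _ _).2 hle),
        (mem_box_iff_natAbs_le _ _).1 hq2⟩
    rw [← Finset.sum_fiberwise_of_maps_to hmaps]
    -- each fibre
    have hfib : ∀ ℓ ∈ Finset.Ioc ℓ₀ M₄, ∑ q ∈ Emid.filter (fun q => ν q = ℓ), f q ≤
        256 * K * (a n * a m) * (n : ℝ) ^ (2 - η) * (ℓ : ℝ) ^ (η - 1) := by
      intro ℓ hℓ
      rw [Finset.mem_Ioc] at hℓ
      have hℓ8 : 8 ≤ ℓ := by omega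
      set h : ℕ := (ℓ - 1) / 2 with hh
      have hh1 : 1 ≤ h := by omega
      have hhN : N₀ ≤ h := by omega
      have hhm : 4 * h ≤ m := by omega
      have hhn : h < n := by omega
      have hℓ0 : (0 : ℝ) < ℓ := by exact_mod_cast (show 0 < ℓ by omega)
      have hh0 : (0 : ℝ) < h := by exact_mod_cast hh1
      -- the pair bound on the fibre
      have hterm : ∀ q ∈ Emid.filter (fun q => ν q = ℓ), f q ≤ a h ^ 2 * α (4 * h) m := by
        intro q hq
        rw [Finset.mem_filter] at hq
        obtain ⟨-, hqℓ⟩ := hq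
        have hνq : max ((q.1 - x) 0).natAbs ((q.1 - x) 1).natAbs = ℓ := hqℓ
        have hfar : q.1 - x ∉ box 2 (2 * h) := by
          rw [mem_box_iff_natAbs_le, hνq]; omega
        have hin : q.1 - x ∈ box 2 (4 * h - 1 - h) := by
          rw [mem_box_iff_natAbs_le, hνq]; omega
        exact real_inter_edgeFourArm_le_sq_mul i q.2 hh1 hfar (by omega) hin hhm
      -- the count of the fibre
      have hcount : ((Emid.filter (fun q => ν q = ℓ)).card : ℝ) ≤ 16 * (ℓ : ℝ) := by
        have hsub : Emid.filter (fun q => ν q = ℓ) ⊆ E.filter (fun q => ν q = ℓ) :=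
          Finset.filter_subset_filter _ ((Finset.filter_subset mid _).trans
            (Finset.filter_subset (fun q => ¬ near q) E))
        exact le_trans (by exact_mod_cast Finset.card_le_card hsub)
          (card_filter_natAbs_eq_le E x (by omega))
      -- the arm algebra
      have harm := armAlgebra_mid hcQ hCQ hcL hη0.le ha0 hQ1' hQ2' hQ3' hh1 hhN hhm hhn
      have hpow : ((n : ℝ) / h) ^ (2 - η) ≤ 16 * ((n : ℝ) ^ (2 - η) * (ℓ : ℝ) ^ (η - 2)) := by
        have hℓ4h : (ℓ : ℝ) ≤ 4 * h := by exact_mod_cast (show ℓ ≤ 4 * h by omega)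
        rw [Real.div_rpow hn0.le hh0.le, div_le_iff₀ (Real.rpow_pos_of_pos hh0 _)]
        have h1 : (ℓ : ℝ) ^ (2 - η) ≤ (4 * (h : ℝ)) ^ (2 - η) :=
          Real.rpow_le_rpow hℓ0.le hℓ4h (by linarith)
        rw [Real.mul_rpow (by norm_num) hh0.le] at h1
        have h4 : (4 : ℝ) ^ (2 - η) ≤ 16 := by
          calc (4 : ℝ) ^ (2 - η) ≤ (4 : ℝ) ^ (2 : ℝ) :=
                Real.rpow_le_rpow_of_exponent_le (by norm_num) (by linarith)
            _ = 16 := by rw [Real.rpow_two]; norm_num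
        have hℓinv : (ℓ : ℝ) ^ (η - 2) * (ℓ : ℝ) ^ (2 - η) = 1 := by
          rw [← Real.rpow_add hℓ0, show η - 2 + (2 - η) = 0 by ring, Real.rpow_zero]
        calc (n : ℝ) ^ (2 - η) = (n : ℝ) ^ (2 - η) * ((ℓ : ℝ) ^ (η - 2) * (ℓ : ℝ) ^ (2 - η)) := by
              rw [hℓinv, mul_one]
          _ ≤ (n : ℝ) ^ (2 - η) * ((ℓ : ℝ) ^ (η - 2) * ((4 : ℝ) ^ (2 - η) * (h : ℝ) ^ (2 - η))) := by
              gcongr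
          _ ≤ (n : ℝ) ^ (2 - η) * ((ℓ : ℝ) ^ (η - 2) * (16 * (h : ℝ) ^ (2 - η))) := by gcongr
          _ = 16 * ((n : ℝ) ^ (2 - η) * (ℓ : ℝ) ^ (η - 2)) * (h : ℝ) ^ (2 - η) := by ring
      have hℓpow : (ℓ : ℝ) * (ℓ : ℝ) ^ (η - 2) = (ℓ : ℝ) ^ (η - 1) := by
        rw [mul_comm, ← Real.rpow_add_one hℓ0.ne', show η - 2 + 1 = η - 1 by ring]
      calc ∑ q ∈ Emid.filter (fun q => ν q = ℓ), f q
          ≤ ∑ q ∈ Emid.filter (fun q => ν q = ℓ), a h ^ 2 * α (4 * h) m := Finset.sum_le_sum hterm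
        _ = ((Emid.filter (fun q => ν q = ℓ)).card : ℝ) * (a h ^ 2 * α (4 * h) m) := by
            rw [Finset.sum_const, nsmul_eq_mul]
        _ ≤ (16 * (ℓ : ℝ)) * (K * (a n * a m) * ((n : ℝ) / h) ^ (2 - η)) := by
            apply mul_le_mul hcount harm (by
              have : 0 ≤ α (4 * h) m := measureReal_nonneg
              positivity) (by positivity)
        _ ≤ (16 * (ℓ : ℝ)) * (K * (a n * a m) * (16 * ((n : ℝ) ^ (2 - η) * (ℓ : ℝ) ^ (η - 2)))) := by
            have : 0 ≤ a n * a m := mul_nonneg (ha0 n) (ha0 m)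
            gcongr
        _ = 256 * K * (a n * a m) * (n : ℝ) ^ (2 - η) * ((ℓ : ℝ) * (ℓ : ℝ) ^ (η - 2)) := by ring
        _ = 256 * K * (a n * a m) * (n : ℝ) ^ (2 - η) * (ℓ : ℝ) ^ (η - 1) := by rw [hℓpow]
    -- summing the fibres
    have hsumℓ : ∑ ℓ ∈ Finset.Ioc ℓ₀ M₄, (ℓ : ℝ) ^ (η - 1) ≤ (n : ℝ) ^ η / η := by
      calc ∑ ℓ ∈ Finset.Ioc ℓ₀ M₄, (ℓ : ℝ) ^ (η - 1)
          ≤ ∑ ℓ ∈ Finset.Icc 1 M₄, (ℓ : ℝ) ^ (η - 1) := by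
            refine Finset.sum_le_sum_of_subset_of_nonneg (fun ℓ hℓ => ?_) fun ℓ _ _ =>
              Real.rpow_nonneg (Nat.cast_nonneg ℓ) _
            rw [Finset.mem_Ioc] at hℓ
            rw [Finset.mem_Icc]
            omega
        _ ≤ (M₄ : ℝ) ^ η / η := sum_rpow_sub_one_le η hη0 hη1 M₄
        _ ≤ (n : ℝ) ^ η / η := by
            gcongr
            exact_mod_cast (show M₄ ≤ n by omega)
    have hnpow : (n : ℝ) ^ (2 - η) * (n : ℝ) ^ η = (n : ℝ) ^ 2 := by
      rw [← Real.rpow_add hn0, show (2 - η) + η = (2 : ℝ) by ring, Real.rpow_two]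
    calc ∑ ℓ ∈ Finset.Ioc ℓ₀ M₄, ∑ q ∈ Emid.filter (fun q => ν q = ℓ), f q
        ≤ ∑ ℓ ∈ Finset.Ioc ℓ₀ M₄, 256 * K * (a n * a m) * (n : ℝ) ^ (2 - η) * (ℓ : ℝ) ^ (η - 1) :=
          Finset.sum_le_sum hfib
      _ = 256 * K * (a n * a m) * (n : ℝ) ^ (2 - η) * ∑ ℓ ∈ Finset.Ioc ℓ₀ M₄, (ℓ : ℝ) ^ (η - 1) := by
          rw [Finset.mul_sum]
      _ ≤ 256 * K * (a n * a m) * (n : ℝ) ^ (2 - η) * ((n : ℝ) ^ η / η) := by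
          have : 0 ≤ a n * a m := mul_nonneg (ha0 n) (ha0 m)
          gcongr
      _ = 256 * K / η * ((n : ℝ) ^ (2 - η) * (n : ℝ) ^ η * (a n * a m)) := by
          simp only [div_eq_mul_inv]
          ring
      _ = 256 * K / η * ((n : ℝ) ^ 2 * (a n * a m)) := by rw [hnpow]
  -- assemble
  rw [hsplit]
  have := add_le_add hNEAR (add_le_add hMID hFAR)
  refine this.trans (le_of_eq ?_)
  ring

end Summit.CriticalPhenomena.CardyFormulaZ2.Theorems.CardyMeckeFlip

end
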